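/-
Copyright (c) 2026 the pub-hodgecm-mathlib formalisation cell (harness21).  Prover seat hodgecm-mathlib-K2E3-p12 (g5) (E3 §L lead on loan to E1 by the CHAIR WORD
«β → E1» 2026-09-04T06:25Z), Track B ∕ K2-LIT, h413 = `stmt-HodgeConjecture-24833`, line `K2_E1_TraceFormulaBeta`, campaign «EIS-RANK-ONE» rung R6h;
DEAL (R6h-a) of the dealer K2E1-plan (g4) 2026-09-04T06:25:54Z (SPEC «EIS-R6h POLE INEQUALITY» v1 §2): THE ELEMENTARY POLE INEQUALITIES extracted from the
DIAGONAL Maass–Selberg relation «four terms ≥ 0» — pure real analysis.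
-/
import Mathlib.Analysis.SpecialFunctions.Pow.Real
import Mathlib.Analysis.SpecialFunctions.Pow.Complex
import Mathlib.Analysis.SpecialFunctions.Pow.Continuity
import Mathlib.Analysis.SpecialFunctions.Sqrt
import Mathlib.Order.Filter.AtTopBot.Basic
import Mathlib.Topology.Order.OrderClosed
import HarnessLib

/-!
# K2·E1 — `K2E1MaassSelbergPoleInequality`: THE POLE INEQUALITIES OF THE RANK-ONE INTERTWINING OPERATOR FROM THE DIAGONAL MAASS–SELBERG RELATION
# (campaign «EIS-RANK-ONE», rung R6h-a: pure real analysis, hypothesis-first)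

Track B ∕ K2-LIT, crux h413 = `stmt-HodgeConjecture-24833`, route of record `HCCMUnconditional`; cell `hodgecm-mathlib`, squad K2, ENGINE E1.  Prover seat
`hodgecm-mathlib-K2E3-p12` (g5) on loan; DEAL (R6h-a) of the dealer K2E1-plan (g4) 2026-09-04T06:25:54Z, REPORT-FIRST 06:3xZ.  THEOREMS ONLY (no `def`, no `instance`,
no notation, no named-fact hypothesis, no `sorry`); lane `--supports stmt-HodgeConjecture-24833 --as helper` (count-neutral).  Closes no socket; no automorphic import.

THE MATHEMATICS [MoeglinWaldspurger1995, IV.3.12 (a)(b) pp. 200–202; Garrett2018, §1.12; Arthur1980TraceFormulaII, §4].  For a section `f` with `a = ‖f‖² > 0`, put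
`b = ‖(M(z)f)~‖² ≥ 0` and `w = ⟨f, (M(z)f)~⟩`, so `|w|² ≤ a·b`; with `x = Re z − ρ_H > 0`, `y = Im z ≠ 0`, `T ≥ 1`, the DIAGONAL Maass–Selberg relation reads
`0 ≤ ‖Λ^T E(f_z)‖² = c_μ·(a·T^{2x}∕(2x) − b·T^{−2x}∕(2x) + Im(w·T^{2iy})∕y)`.  This file keeps the oscillatory term ABSTRACT: a real `c` with `|c| ≤ √(ab)∕|y|`
(§1 `abs_im_mul_div_le` produces it from `c = Im(w·u)∕y`, `‖u‖ ≤ 1`, and `‖T^{it}‖ = 1`).  Then: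
* §2 (a1) **`sqrt_le_of_maassSelbergDiag`** — the quadratic inequality `b ≤ a·T^{4x} + (2xT^{2x}√a∕|y|)·√b` gives the explicit bound
  `√b ≤ x·T^{2x}·√a∕|y| + √(x²·T^{4x}·a∕y² + a·T^{4x})`, continuous on `{x > 0, y ≠ 0}`; `le_of_maassSelbergDiag` is the squared form.
* §3 (a2) **`le_of_maassSelbergDiag_of_mem_box`** — on `{x ∈ [x₁,x₂], |y| ≥ η}` (`x₁, η > 0`) the bound is UNIFORM: «no pole off the real axis».
* §4 (a3) **`le_div_sq_of_maassSelbergDiag`** — for `0 < |y| ≤ 1`: `b ≤ C(a,T,x)∕y²`: «poles at real points have order ≤ 1 along vertical approach».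
* §5 (a4) **`limit_le_of_maassSelbergDiag`** — if the relation holds for all `x ∈ (0, x₂]` at fixed `y ≠ 0` and `b(x) → b₀` as `x → 0⁺`, then `b₀ ≤ a`:
  «`‖M‖ ≤ 1` on the unitary axis» (multiply by `2x`, `T^{±2x} → 1`, `2x·√(a·b(x))∕|y| → 0`).
HONEST LABEL: HC_CM is proved only modulo the 7 printed citations (2 remaining named inputs: hLiu418 = `stmt-HodgeConjecture-24832`, h413 = `stmt-HodgeConjecture-24833`)
until rung 0 closes; this file asserts no named fact and closes no socket.
References: [MoeglinWaldspurger1995] IV.3.12 · [Garrett2018] §1.12 · [Arthur1980TraceFormulaII] §4.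
-/

set_option autoImplicit false
-- the mandated namespace repeats the single-problem summit's segment (`HodgeConjecture.HodgeConjecture`)
set_option linter.dupNamespace false

noncomputable section

open Filter Topology Set

namespace Summit.HodgeConjecture.HodgeConjecture.Cruxes.H413.K2E1MaassSelbergPoleInequality

/-! ## §1  The oscillatory term -/

/-- `‖T^{it}‖ = 1` for real `T > 0`, `t : ℝ`. [folklore] -/
theorem norm_ofReal_cpow_mul_I {T : ℝ} (hT : 0 < T) (t : ℝ) : ‖(T : ℂ) ^ ((t : ℂ) * Complex.I)‖ = 1 := by
  rw [Complex.norm_cpow_eq_rpow_re_of_pos hT]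
  simp

/-- **The oscillatory term is dominated by Cauchy–Schwarz**: `|Im(w·u)∕y| ≤ √(ab)∕|y|` when `‖u‖ ≤ 1` and `‖w‖² ≤ a·b`.
[cite: MoeglinWaldspurger1995, IV.3.12] -/
theorem abs_im_mul_div_le {w u : ℂ} {a b : ℝ} (hu : ‖u‖ ≤ 1) (hw : ‖w‖ ^ 2 ≤ a * b) (y : ℝ) :
    |(w * u).im / y| ≤ Real.sqrt (a * b) / |y| := by
  rw [abs_div]
  refine div_le_div_of_nonneg_right ?_ (abs_nonneg y)
  have h1 : |(w * u).im| ≤ ‖w * u‖ := Complex.abs_im_le_norm _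
  have h2 : ‖w * u‖ ≤ ‖w‖ := by
    rw [norm_mul]
    exact mul_le_of_le_one_right (norm_nonneg _) hu
  have h3 : ‖w‖ ≤ Real.sqrt (a * b) := by
    rw [← Real.sqrt_sq (norm_nonneg w)]
    exact Real.sqrt_le_sqrt hw
  exact h1.trans (h2.trans h3)

/-! ## §2  (a1) The explicit bound -/

/-- The quadratic inequality: `s² ≤ q + p·s` ⟹ `s ≤ p∕2 + √(p²∕4 + q)`. [folklore] -/
theorem le_of_sq_le_add_mul {s p q : ℝ} (h : s ^ 2 ≤ q + p * s) : s ≤ p / 2 + Real.sqrt (p ^ 2 / 4 + q) := by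
  have h1 : (s - p / 2) ^ 2 ≤ p ^ 2 / 4 + q := by nlinarith
  have h2 : s - p / 2 ≤ Real.sqrt (p ^ 2 / 4 + q) := by
    calc s - p / 2 ≤ |s - p / 2| := le_abs_self _
      _ = Real.sqrt ((s - p / 2) ^ 2) := (Real.sqrt_sq_eq_abs _).symm
      _ ≤ Real.sqrt (p ^ 2 / 4 + q) := Real.sqrt_le_sqrt h1
  linarith

/-- **(a1) THE POLE INEQUALITY**: from `0 ≤ a·T^{2x}∕(2x) − b·T^{−2x}∕(2x) + c` with `|c| ≤ √(ab)∕|y|` (`a > 0`, `b ≥ 0`, `T ≥ 1`, `x > 0`, `y ≠ 0`):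
`√b ≤ x·T^{2x}·√a∕|y| + √(x²·T^{4x}·a∕y² + a·T^{4x})`. [cite: MoeglinWaldspurger1995, IV.3.12 (a)] [cite: Garrett2018, §1.12] -/
theorem sqrt_le_of_maassSelbergDiag {a b T x y c : ℝ} (ha : 0 < a) (hb : 0 ≤ b) (hT : 1 ≤ T) (hx : 0 < x) (hy : y ≠ 0)
    (hc : |c| ≤ Real.sqrt (a * b) / |y|) (hMS : 0 ≤ a * T ^ (2 * x) / (2 * x) - b * T ^ (-(2 * x)) / (2 * x) + c) :
    Real.sqrt b ≤ x * T ^ (2 * x) * Real.sqrt a / |y| + Real.sqrt (x ^ 2 * T ^ (4 * x) * a / y ^ 2 + a * T ^ (4 * x)) := by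
  have hT0 : 0 < T := lt_of_lt_of_le one_pos hT
  set P : ℝ := T ^ (2 * x) with hP
  have hP0 : 0 < P := Real.rpow_pos_of_pos hT0 _
  have hy0 : 0 < |y| := abs_pos.2 hy
  have hneg : T ^ (-(2 * x)) = P⁻¹ := Real.rpow_neg hT0.le _
  have h4 : T ^ (4 * x) = P * P := by
    rw [show (4 : ℝ) * x = 2 * x + 2 * x by ring, Real.rpow_add hT0]
  have hcle : c ≤ Real.sqrt (a * b) / |y| := (le_abs_self c).trans hc
  -- `b/(P·2x) ≤ aP/(2x) + √(ab)/|y|`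
  have key : b / (P * (2 * x)) ≤ a * P / (2 * x) + Real.sqrt (a * b) / |y| := by
    have : b * T ^ (-(2 * x)) / (2 * x) = b / (P * (2 * x)) := by
      rw [hneg, div_eq_mul_inv, div_eq_mul_inv, mul_assoc, ← mul_inv]
    linarith [hMS, this]
  -- multiply by `P·2x > 0`
  have key2 : b ≤ a * (P * P) + (2 * x * P * Real.sqrt a / |y|) * Real.sqrt b := by
    have hpos : 0 < P * (2 * x) := by positivity
    have := (div_le_iff₀ hpos).1 key
    have hsq : Real.sqrt (a * b) = Real.sqrt a * Real.sqrt b := Real.sqrt_mul ha.le b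
    rw [hsq] at this
    have hexp : (a * P / (2 * x) + Real.sqrt a * Real.sqrt b / |y|) * (P * (2 * x)) =
        a * (P * P) + (2 * x * P * Real.sqrt a / |y|) * Real.sqrt b := by
      field_simp
    linarith [this, hexp]
  -- the quadratic inequality in `s = √b`
  have hs : Real.sqrt b ^ 2 ≤ a * (P * P) + (2 * x * P * Real.sqrt a / |y|) * Real.sqrt b := by rwa [Real.sq_sqrt hb]
  have hmain := le_of_sq_le_add_mul hs
  -- rewrite the two constants
  have hp2 : 2 * x * P * Real.sqrt a / |y| / 2 = x * T ^ (2 * x) * Real.sqrt a / |y| := by rw [hP]; ring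
  have hq : (2 * x * P * Real.sqrt a / |y|) ^ 2 / 4 + a * (P * P) = x ^ 2 * T ^ (4 * x) * a / y ^ 2 + a * T ^ (4 * x) := by
    rw [h4, div_pow, mul_pow, mul_pow, mul_pow, Real.sq_sqrt ha.le, sq_abs, hP]; ring
  rwa [hp2, hq] at hmain

/-- **(a1), squared form**: `b ≤ (x·T^{2x}·√a∕|y| + √(x²·T^{4x}·a∕y² + a·T^{4x}))²`. [cite: MoeglinWaldspurger1995, IV.3.12 (a)] -/
theorem le_of_maassSelbergDiag {a b T x y c : ℝ} (ha : 0 < a) (hb : 0 ≤ b) (hT : 1 ≤ T) (hx : 0 < x) (hy : y ≠ 0)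
    (hc : |c| ≤ Real.sqrt (a * b) / |y|) (hMS : 0 ≤ a * T ^ (2 * x) / (2 * x) - b * T ^ (-(2 * x)) / (2 * x) + c) :
    b ≤ (x * T ^ (2 * x) * Real.sqrt a / |y| + Real.sqrt (x ^ 2 * T ^ (4 * x) * a / y ^ 2 + a * T ^ (4 * x))) ^ 2 := by
  have h := sqrt_le_of_maassSelbergDiag ha hb hT hx hy hc hMS
  calc b = Real.sqrt b ^ 2 := (Real.sq_sqrt hb).symm
    _ ≤ _ := pow_le_pow_left₀ (Real.sqrt_nonneg b) h 2

/-! ## §3  (a2) Uniform bound on a box off the real axis -/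

/-- **(a2) «NO POLE OFF THE REAL AXIS»**: on the box `x ∈ [x₁, x₂]` (`x₁ > 0`), `|y| ≥ η > 0`, the bound of (a1) is uniform:
`b ≤ (x₂·T^{2x₂}·√a∕η + √(x₂²·T^{4x₂}·a∕η² + a·T^{4x₂}))²`. [cite: MoeglinWaldspurger1995, IV.3.12 (a)] [cite: Garrett2018, §1.12] -/
theorem le_of_maassSelbergDiag_of_mem_box {a b T x y c x₁ x₂ η : ℝ} (ha : 0 < a) (hb : 0 ≤ b) (hT : 1 ≤ T) (hx₁ : 0 < x₁) (hx : x ∈ Set.Icc x₁ x₂)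
    (hη : 0 < η) (hy : η ≤ |y|) (hc : |c| ≤ Real.sqrt (a * b) / |y|) (hMS : 0 ≤ a * T ^ (2 * x) / (2 * x) - b * T ^ (-(2 * x)) / (2 * x) + c) :
    b ≤ (x₂ * T ^ (2 * x₂) * Real.sqrt a / η + Real.sqrt (x₂ ^ 2 * T ^ (4 * x₂) * a / η ^ 2 + a * T ^ (4 * x₂))) ^ 2 := by
  have hx0 : 0 < x := lt_of_lt_of_le hx₁ hx.1
  have hy0 : y ≠ 0 := abs_pos.1 (lt_of_lt_of_le hη hy)
  have h := sqrt_le_of_maassSelbergDiag ha hb hT hx0 hy0 hc hMS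
  have hT2 : T ^ (2 * x) ≤ T ^ (2 * x₂) := Real.rpow_le_rpow_of_exponent_le hT (by linarith [hx.2])
  have hT4 : T ^ (4 * x) ≤ T ^ (4 * x₂) := Real.rpow_le_rpow_of_exponent_le hT (by linarith [hx.2])
  have hT2n : 0 ≤ T ^ (2 * x) := Real.rpow_nonneg (by linarith) _
  have hT4n : 0 ≤ T ^ (4 * x) := Real.rpow_nonneg (by linarith) _
  have hxx : x ≤ x₂ := hx.2
  have hx2 : x ^ 2 ≤ x₂ ^ 2 := pow_le_pow_left₀ hx0.le hxx 2
  have hyy : y ^ 2 ≥ η ^ 2 := by rw [← sq_abs y]; exact pow_le_pow_left₀ hη.le hy 2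
  have hbound : x * T ^ (2 * x) * Real.sqrt a / |y| + Real.sqrt (x ^ 2 * T ^ (4 * x) * a / y ^ 2 + a * T ^ (4 * x)) ≤
      x₂ * T ^ (2 * x₂) * Real.sqrt a / η + Real.sqrt (x₂ ^ 2 * T ^ (4 * x₂) * a / η ^ 2 + a * T ^ (4 * x₂)) := by
    have hsa : 0 ≤ Real.sqrt a := Real.sqrt_nonneg a
    have hx₂0 : 0 ≤ x₂ := hx0.le.trans hxx
    have hT2n' : 0 ≤ T ^ (2 * x₂) := Real.rpow_nonneg (by linarith) _
    gcongr
  calc b = Real.sqrt b ^ 2 := (Real.sq_sqrt hb).symm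
    _ ≤ _ := pow_le_pow_left₀ (Real.sqrt_nonneg b) (h.trans hbound) 2

/-! ## §4  (a3) Order at most one along vertical approach to a real point -/

/-- **(a3) «ORDER ≤ 1 AT REAL POINTS»**: for fixed `x > 0` and `0 < |y| ≤ 1`, `b ≤ C(a,T,x)∕y²` with `C = (x·T^{2x}·√a + √(x²·T^{4x}·a + a·T^{4x}))²`.
[cite: MoeglinWaldspurger1995, IV.3.12 (a)] [cite: Garrett2018, §1.12] -/
theorem le_div_sq_of_maassSelbergDiag {a b T x y c : ℝ} (ha : 0 < a) (hb : 0 ≤ b) (hT : 1 ≤ T) (hx : 0 < x) (hy0 : y ≠ 0) (hy1 : |y| ≤ 1)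
    (hc : |c| ≤ Real.sqrt (a * b) / |y|) (hMS : 0 ≤ a * T ^ (2 * x) / (2 * x) - b * T ^ (-(2 * x)) / (2 * x) + c) :
    b ≤ (x * T ^ (2 * x) * Real.sqrt a + Real.sqrt (x ^ 2 * T ^ (4 * x) * a + a * T ^ (4 * x))) ^ 2 / y ^ 2 := by
  have h := sqrt_le_of_maassSelbergDiag ha hb hT hx hy0 hc hMS
  have hya : 0 < |y| := abs_pos.2 hy0
  have hT4n : 0 ≤ T ^ (4 * x) := Real.rpow_nonneg (by linarith) _
  -- `√(A/y² + B) ≤ √(A + B)/|y|` for `|y| ≤ 1`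
  have hAB : Real.sqrt (x ^ 2 * T ^ (4 * x) * a / y ^ 2 + a * T ^ (4 * x)) ≤ Real.sqrt (x ^ 2 * T ^ (4 * x) * a + a * T ^ (4 * x)) / |y| := by
    rw [le_div_iff₀ hya, ← Real.sqrt_sq hya.le, ← Real.sqrt_mul (by positivity)]
    refine Real.sqrt_le_sqrt ?_
    rw [sq_abs, add_mul, div_mul_cancel₀ _ (pow_ne_zero 2 hy0)]
    have hy2 : y ^ 2 ≤ 1 := by rw [← sq_abs]; exact pow_le_one₀ (abs_nonneg y) hy1
    nlinarith [mul_nonneg ha.le hT4n]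
  have hbound : Real.sqrt b ≤ (x * T ^ (2 * x) * Real.sqrt a + Real.sqrt (x ^ 2 * T ^ (4 * x) * a + a * T ^ (4 * x))) / |y| := by
    rw [add_div]
    exact h.trans (add_le_add le_rfl hAB)
  have hnn : 0 ≤ (x * T ^ (2 * x) * Real.sqrt a + Real.sqrt (x ^ 2 * T ^ (4 * x) * a + a * T ^ (4 * x))) / |y| :=
    (Real.sqrt_nonneg b).trans hbound
  calc b = Real.sqrt b ^ 2 := (Real.sq_sqrt hb).symm
    _ ≤ ((x * T ^ (2 * x) * Real.sqrt a + Real.sqrt (x ^ 2 * T ^ (4 * x) * a + a * T ^ (4 * x))) / |y|) ^ 2 :=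
        pow_le_pow_left₀ (Real.sqrt_nonneg b) hbound 2
    _ = _ := by rw [div_pow, sq_abs]

/-! ## §5  (a4) The unitary axis -/

/-- **(a4) «`‖M‖ ≤ 1` AT THE UNITARY AXIS»**: if the diagonal relation holds for every `x ∈ (0, x₂]` at a fixed `y ≠ 0` with data `b(x) ≥ 0`, `|c(x)| ≤ √(a·b(x))∕|y|`,
and `b(x) → b₀` as `x → 0⁺`, then `b₀ ≤ a` (multiply by `2x > 0` and let `x → 0⁺`: `T^{±2x} → 1`, `2x·c(x) → 0`).
[cite: MoeglinWaldspurger1995, IV.3.12 (b)] [cite: Garrett2018, §1.12] -/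
theorem limit_le_of_maassSelbergDiag {a T y x₂ b₀ : ℝ} {b c : ℝ → ℝ} (hT : 1 ≤ T) (hy : y ≠ 0) (hx₂ : 0 < x₂)
    (hc : ∀ x ∈ Set.Ioc 0 x₂, |c x| ≤ Real.sqrt (a * b x) / |y|)
    (hMS : ∀ x ∈ Set.Ioc 0 x₂, 0 ≤ a * T ^ (2 * x) / (2 * x) - b x * T ^ (-(2 * x)) / (2 * x) + c x)
    (hb₀ : Tendsto b (𝓝[>] 0) (𝓝 b₀)) : b₀ ≤ a := by
  have hT0 : 0 < T := lt_of_lt_of_le one_pos hT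
  have hy0 : 0 < |y| := abs_pos.2 hy
  -- the relation multiplied by `2x`: `b(x)·T^{−2x} ≤ a·T^{2x} + 2x·√(a·b x)/|y|` on `(0, x₂]`
  have hineq : ∀ x ∈ Set.Ioc 0 x₂, b x * T ^ (-(2 * x)) ≤ a * T ^ (2 * x) + 2 * x * (Real.sqrt (a * b x) / |y|) := by
    intro x hx
    have hx0 : 0 < x := hx.1
    have h2x : 0 < 2 * x := by linarith
    have h1 := hMS x hx
    have h2 : c x ≤ Real.sqrt (a * b x) / |y| := (le_abs_self _).trans (hc x hx)
    have h3 : 0 ≤ a * T ^ (2 * x) - b x * T ^ (-(2 * x)) + 2 * x * c x := by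
      have := mul_nonneg h2x.le h1
      have hexp : 2 * x * (a * T ^ (2 * x) / (2 * x) - b x * T ^ (-(2 * x)) / (2 * x) + c x) =
          a * T ^ (2 * x) - b x * T ^ (-(2 * x)) + 2 * x * c x := by
        field_simp
      linarith [this, hexp]
    nlinarith [mul_le_mul_of_nonneg_left h2 h2x.le]
  -- both sides converge as `x → 0⁺`
  have hIoc : Set.Ioc 0 x₂ ∈ 𝓝[>] (0 : ℝ) := Ioc_mem_nhdsGT hx₂
  have hpow : ∀ s : ℝ, Tendsto (fun x : ℝ => T ^ (s * x)) (𝓝[>] 0) (𝓝 1) := by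
    intro s
    have hcont : Continuous fun x : ℝ => T ^ (s * x) := (Real.continuous_const_rpow hT0.ne').comp (continuous_const.mul continuous_id)
    have h0 : Tendsto (fun x : ℝ => T ^ (s * x)) (𝓝[>] 0) (𝓝 (T ^ (s * 0))) := (hcont.tendsto 0).mono_left nhdsWithin_le_nhds
    simpa using h0
  have hneg : ∀ x : ℝ, T ^ (-(2 * x)) = T ^ ((-2) * x) := fun x => by ring_nf
  have hL : Tendsto (fun x => b x * T ^ (-(2 * x))) (𝓝[>] 0) (𝓝 (b₀ * 1)) := by
    simp only [hneg]
    exact hb₀.mul (hpow (-2))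
  have hsqrt : Tendsto (fun x => Real.sqrt (a * b x)) (𝓝[>] 0) (𝓝 (Real.sqrt (a * b₀))) :=
    (hb₀.const_mul a).sqrt
  have hR : Tendsto (fun x => a * T ^ (2 * x) + 2 * x * (Real.sqrt (a * b x) / |y|)) (𝓝[>] 0) (𝓝 (a * 1 + 2 * 0 * (Real.sqrt (a * b₀) / |y|))) := by
    refine ((hpow 2).const_mul a).add ?_
    have hx0 : Tendsto (fun x : ℝ => x) (𝓝[>] (0 : ℝ)) (𝓝 0) := (continuous_id.tendsto 0).mono_left nhdsWithin_le_nhds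
    exact (hx0.const_mul 2).mul (hsqrt.div_const _)
  have hle := le_of_tendsto_of_tendsto hL hR (Filter.eventually_of_mem hIoc hineq)
  simpa using hle

end Summit.HodgeConjecture.HodgeConjecture.Cruxes.H413.K2E1MaassSelbergPoleInequality

end
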